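import Summits.HodgeConjecture.HodgeConjecture.Theorems.Ring2WeilCoverageJohnsonClassLaw
import HarnessLib

/-!
# Weil-type family coverage — THEOREM J3 (the pair windows of all six carriers, uniformly in `n`) (ring2-b02, gen 72)

research route conditional on HC_CM; not a corollary; Q11.4-sentence-2 already refuted in dim ≥ 3.

Ring 2, WEIL-TYPE FAMILY-COVERAGE CENSUS (`HOME/WEIL-FAMILY-COVERAGE.md` `## b02 (g = 6)`, block b02.32, owner ring2-b02).
THEOREM J2 (block b02.31, file `Ring2WeilCoverageJohnsonClassLaw` §5) closed the PAIR windows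
`(G₁ × S_n|A_n, λ ⊠ S^{(n−2,2)})` of four of the six `g = 6` carriers for every `n` by LP-duality caps, and left open, uniformly in `n`,
the 21 reflection multisets of `G₂₄` and `η₅`'s `(2A, 3A, 11)`.  Block b02.32 closes them (and re-proves the other four carriers with
smaller thresholds) by a LAGRANGIAN KERNEL BOUND:

* LEMMA Q (exact identity).  For a slot class `(h : y)`, `y ∈ S_n` with cycle lengths `ℓ_1, …, ℓ_c`, `u(y) = n − c`, and a
  multiplier `T ≥ 0`:  `Fix(h:y) + T·n·u(y) = ½ Σ_{i,j} ℓ_i ℓ_j K_h(ℓ_i, ℓ_j; T, 1/n)` with the explicit kernel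
  `K_h(ℓ,ℓ';T,ξ) = s_h(lcm)/lcm + T(2 − 1/ℓ − 1/ℓ') − ξ(c_h(ℓ)/ℓ + c_h(ℓ')/ℓ')` (`s_h(L)` = number of eigenvalues of `λ(h)` of order
  dividing `L`; `c_h(ℓ) = 3/2·s_h(ℓ)` for odd `ℓ`, `2 s_h(ℓ) − s_h(ℓ/2)` for even `ℓ`) — the pair-orbit count plus Young's rule, the
  multiplier and the diagonal terms distributed into the quadratic form (§1);
* LEMMA K.  `Fix(h:y) + T n u(y) ≤ (n²/2)·Ψ_h(T, 1/n)`, `Ψ_h` = the supremum of the kernel (§2), a finite maximum by LEMMA Σ (§3: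
  `K = 2T + N/(gab)` on the class `ℓ = ga, ℓ' = gb`, monotone in `g`);
* THEOREM J3.  Riemann–Hurwitz `Σ_j u_j ≥ 2n − 2` and the budget `Σ_j Fix_j = (N−2)·f·n(n−3)/2 − 6` are incompatible for every
  `n ≥ n₀` as soon as the concave function `S_σ(ξ) = (c−2)f(1−3ξ) + 4T(1−ξ) − 12ξ² − Σ_{h∈σ} Ψ_h(T,ξ)` is positive at `ξ = 0` and at
  `ξ = 1/n₀` (§4: the budget algebra and the two-endpoint principle); pure slots are neutral, and `c ≥ 5` carrier slots are handled
  uniformly by the `δ`-argument (§4);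
* §5: the endpoint arithmetic of the worst certificates of record — `G₂₄` `(−2, −7a, 3)` (`T = 3/8`, `n₀ = 16`), `η₅ = PSL₂(11)`
  `(11a, 2A, 3A)` (`T = 19/48`, `n₀ = 13`), `G₂₄`'s uniform `c ≥ 5` test (`T = 13/48`, `n₀ = 8`) — at the maximising kernel pairs
  found by the engine (`weilcov/g72/john/lagr2.py`, exact rationals; LEMMA Q verified against Young's rule on every cycle type `n ≤ 11`,
  LEMMA K against every cycle type `n ≤ 27`, the certificates against the exact relaxation `n ≤ 26`).

Thresholds of record (all signatures of the carrier; any number of branch points and of pure slots; both `S_n` and `A_n`):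
`GL₂(3)` `n ≥ 18`, `SD₁₆` `n ≥ 11`, `PSL₂(7)` `n ≥ 16`, `F₂₁` `n ≥ 8` (its two Euclidean signatures `(3a)³`, `(3b)³` by THEOREM J2 (iii),
`n ≥ 10`), `G₂₄` `n ≥ 16`, `PSL₂(11)` `n ≥ 13`; the exact relaxation carries pair-window data only for `n ≤ 12`, all on old rows.
Nothing in this file is a statement about Hodge classes; `HC_CM` is used nowhere; no `def`, no named fact.
References: [cite: vanGeemen1994HodgeAV, 5.2 and (5.4.1)] (the Weil-type bookkeeping these windows feed); the symmetric-group facts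
(Young's rule for two-row shapes, pair-orbit counts) are classical and are re-derived, not cited.
-/

noncomputable section

set_option linter.dupNamespace false

open Finset

namespace Summit.HodgeConjecture.HodgeConjecture.Ring2.WeilCoverage

namespace LagrangianPairWindows

/-! ### §1 LEMMA Q — distributing the multiplier and the diagonal terms into the quadratic form -/

/-- The diagonal correction for an ODD cycle length `ℓ`: the symmetrised pair form counts `ℓ·s/2` on the diagonal while the true
within-cycle contribution (pair orbits inside the cycle minus the `M¹` term) is `s·(ℓ−3)/2`; the difference is the constant `c = 3s/2`.
research route conditional on HC_CM; not a corollary; Q11.4-sentence-2 already refuted in dim ≥ 3. [folklore] -/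
theorem diag_odd (s ℓ : ℚ) : ℓ * s / 2 - s * (ℓ - 3) / 2 = 3 / 2 * s := by ring

/-- The diagonal correction for an EVEN cycle length `ℓ` (`s = s_h(ℓ)`, `s₂ = s_h(ℓ/2)`, the antipodal pair orbit of length `ℓ/2`):
`ℓ·s/2 − (s(ℓ−4)/2 + s₂) = 2s − s₂`.
research route conditional on HC_CM; not a corollary; Q11.4-sentence-2 already refuted in dim ≥ 3. [folklore] -/
theorem diag_even (s s₂ ℓ : ℚ) : ℓ * s / 2 - (s * (ℓ - 4) / 2 + s₂) = 2 * s - s₂ := by ring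

/-- One term of the multiplier distribution: `ℓℓ'(2 − 1/ℓ − 1/ℓ') = 2ℓℓ' − ℓ' − ℓ`.
research route conditional on HC_CM; not a corollary; Q11.4-sentence-2 already refuted in dim ≥ 3. [folklore] -/
theorem multiplier_term (a b : ℚ) (ha : a ≠ 0) (hb : b ≠ 0) :
    a * b * (2 - 1 / a - 1 / b) = 2 * a * b - b - a := by
  field_simp

/-- **The multiplier distributes into the quadratic form:** over the cycles `i ∈ s` of `y` (lengths `ℓ i`, `Σ ℓ = n`, `|s| = c`),
`Σ_i Σ_j (2 ℓ_i ℓ_j − ℓ_j − ℓ_i) = 2 n² − 2 c n = 2 n·u(y)` (`u = n − c`).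
research route conditional on HC_CM; not a corollary; Q11.4-sentence-2 already refuted in dim ≥ 3. [folklore] -/
theorem multiplier_distribution {ι : Type*} (s : Finset ι) (ℓ : ι → ℚ) :
    ∑ i ∈ s, ∑ j ∈ s, (2 * ℓ i * ℓ j - ℓ j - ℓ i) = 2 * (∑ i ∈ s, ℓ i) ^ 2 - 2 * s.card * ∑ i ∈ s, ℓ i := by
  have h1 : ∑ i ∈ s, ∑ j ∈ s, (2 * ℓ i * ℓ j) = 2 * (∑ i ∈ s, ℓ i) ^ 2 := by
    rw [sq, Finset.sum_mul_sum, Finset.mul_sum]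
    refine Finset.sum_congr rfl fun i _ => ?_
    rw [Finset.mul_sum]
    refine Finset.sum_congr rfl fun j _ => ?_
    ring
  have h2 : ∑ i ∈ s, ∑ j ∈ s, ℓ j = s.card * ∑ j ∈ s, ℓ j := by
    rw [Finset.sum_const, nsmul_eq_mul]
  have h3 : ∑ i ∈ s, ∑ j ∈ s, ℓ i = s.card * ∑ i ∈ s, ℓ i := by
    rw [Finset.sum_comm, Finset.sum_const, nsmul_eq_mul]
  simp only [Finset.sum_sub_distrib, h1, h2, h3]
  ring

/-- **A linear (diagonal) term distributes too:** `Σ_i Σ_j ℓ_j·c_i = (Σ ℓ)·(Σ c) = n·Σ_i c_i`, i.e. `Σ_i c_h(ℓ_i) = (1/n) Σ_{i,j} ℓ_iℓ_j·(c_h(ℓ_i)/ℓ_i)`.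
research route conditional on HC_CM; not a corollary; Q11.4-sentence-2 already refuted in dim ≥ 3. [folklore] -/
theorem diagonal_distribution {ι : Type*} (s : Finset ι) (ℓ c : ι → ℚ) :
    ∑ i ∈ s, ∑ j ∈ s, ℓ j * c i = (∑ j ∈ s, ℓ j) * ∑ i ∈ s, c i := by
  rw [Finset.sum_mul_sum, Finset.sum_comm]

/-! ### §2 LEMMA K — the kernel supremum bounds the quadratic form -/

/-- **LEMMA K.**  If every kernel value is `≤ Ψ` and the weights are non-negative, the quadratic form is at most `(Σ ℓ)²·Ψ = n²·Ψ`;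
with LEMMA Q: `Fix(h:y) + T n u(y) ≤ (n²/2)·Ψ_h(T, 1/n)`.
research route conditional on HC_CM; not a corollary; Q11.4-sentence-2 already refuted in dim ≥ 3. [folklore] -/
theorem kernel_sup_bound {ι : Type*} (s : Finset ι) (ℓ : ι → ℚ) (K : ι → ι → ℚ) (Ψ : ℚ)
    (hℓ : ∀ i ∈ s, 0 ≤ ℓ i) (hK : ∀ i ∈ s, ∀ j ∈ s, K i j ≤ Ψ) :
    ∑ i ∈ s, ∑ j ∈ s, ℓ i * ℓ j * K i j ≤ (∑ i ∈ s, ℓ i) ^ 2 * Ψ := by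
  have : (∑ i ∈ s, ℓ i) ^ 2 * Ψ = ∑ i ∈ s, ∑ j ∈ s, ℓ i * ℓ j * Ψ := by
    rw [sq, Finset.sum_mul_sum, Finset.sum_mul]
    refine Finset.sum_congr rfl fun i _ => ?_
    rw [Finset.sum_mul]
  rw [this]
  refine Finset.sum_le_sum fun i hi => Finset.sum_le_sum fun j hj => ?_
  exact mul_le_mul_of_nonneg_left (hK i hi j hj) (mul_nonneg (hℓ i hi) (hℓ j hj))

/-! ### §3 LEMMA Σ — the supremum of the kernel is a finite maximum -/

/-- **LEMMA Σ, the class form of the kernel.**  For `ℓ = g a`, `ℓ' = g b` (`lcm = g a b` when `gcd(a,b) = 1`):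
`s/(gab) + T(2 − 1/(ga) − 1/(gb)) − ξ(c/(ga) + c'/(gb)) = 2T + N/(gab)` with `N = s − T(a+b) − ξ(b c + a c')`.
research route conditional on HC_CM; not a corollary; Q11.4-sentence-2 already refuted in dim ≥ 3. [folklore] -/
theorem kernel_class_form (s T ξ c c' g a b : ℚ) (hg : g ≠ 0) (ha : a ≠ 0) (hb : b ≠ 0) :
    s / (g * a * b) + T * (2 - 1 / (g * a) - 1 / (g * b)) - ξ * (c / (g * a) + c' / (g * b))
      = 2 * T + (s - T * (a + b) - ξ * (b * c + a * c')) / (g * a * b) := by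
  field_simp
  ring

/-- **LEMMA Σ, the numerator bound:** `N ≤ f − T(a+b)` (`s ≤ f` eigenvalues, `ξ ≥ 0`, `c, c' ≥ 0`, `a, b ≥ 0`).  Hence `N > 0` forces
`T(a+b) < f`, and `K > V > 2T` forces `gab < f/(V − 2T)`: only finitely many classes can carry the supremum.
research route conditional on HC_CM; not a corollary; Q11.4-sentence-2 already refuted in dim ≥ 3. [folklore] -/
theorem numerator_le (s f T a b ξ c c' : ℚ) (hs : s ≤ f) (hξ : 0 ≤ ξ) (ha : 0 ≤ a) (hb : 0 ≤ b) (hc : 0 ≤ c) (hc' : 0 ≤ c') :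
    s - T * (a + b) - ξ * (b * c + a * c') ≤ f - T * (a + b) := by
  nlinarith [mul_nonneg hξ (add_nonneg (mul_nonneg hb hc) (mul_nonneg ha hc'))]

/-- **LEMMA Σ, monotonicity in the class:** for `N ≥ 0` the value `2T + N/(g a b)` decreases in `g`, so the class maximum is at the
least `g` of the class (`g = gcd(g, 2M)` itself); for `N ≤ 0` the value is `≤ 2T`.
research route conditional on HC_CM; not a corollary; Q11.4-sentence-2 already refuted in dim ≥ 3. [folklore] -/
theorem class_monotone (N T g g' ab : ℚ) (hN : 0 ≤ N) (hg : 0 < g) (hgg : g ≤ g') (hab : 0 < ab) :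
    2 * T + N / (g' * ab) ≤ 2 * T + N / (g * ab) := by
  have hg' : 0 < g' := lt_of_lt_of_le hg hgg
  have h : N / (g' * ab) ≤ N / (g * ab) :=
    div_le_div_of_nonneg_left hN (mul_pos hg hab) (mul_le_mul_of_nonneg_right hgg hab.le)
  linarith

/-- **LEMMA Σ, the non-positive class:** `N ≤ 0` gives a kernel value `≤ 2T`.
research route conditional on HC_CM; not a corollary; Q11.4-sentence-2 already refuted in dim ≥ 3. [folklore] -/
theorem class_nonpos (N T L : ℚ) (hN : N ≤ 0) (hL : 0 < L) : 2 * T + N / L ≤ 2 * T := by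
  have : N / L ≤ 0 := div_nonpos_of_nonpos_of_nonneg hN hL.le
  linarith

/-! ### §4 THEOREM J3 — the budget algebra, the two-endpoint principle, pure slots, `c ≥ 5` -/

/-- **THEOREM J3, the budget algebra.**  From LEMMA K summed over the slots (`F = Σ Fix_j`, `U = Σ u_j`, `P = Σ_j Ψ_{h_j}(T, 1/n)`),
Riemann–Hurwitz `U ≥ 2n − 2`, `T ≥ 0`, and the certificate inequality `S_σ(1/n) > 0`, the budget FAILS:
`F < (c−2)·f·n(n−3)/2 − 6` — the window carries no datum of a Weil-type sixfold (`m = 6` would need equality with `(N−2) d − 6`,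
and pure slots only add `f·n(n−3)/2` to the right and at most `(n²/2)·f(1−3/n)` to the left).
research route conditional on HC_CM; not a corollary; Q11.4-sentence-2 already refuted in dim ≥ 3. [cite: vanGeemen1994HodgeAV, (5.4.1)] -/
theorem budget_exclusion (n f T c P F U : ℚ) (hn : 0 < n) (hT : 0 ≤ T) (hK : F + T * n * U ≤ n ^ 2 / 2 * P) (hU : 2 * n - 2 ≤ U)
    (hS : 0 < (c - 2) * f * (1 - 3 / n) + 4 * T * (1 - 1 / n) - 12 / n ^ 2 - P) :
    F < (c - 2) * f * (n * (n - 3) / 2) - 6 := by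
  have hn' : n ≠ 0 := ne_of_gt hn
  have h1 : T * n * (2 * n - 2) ≤ T * n * U := mul_le_mul_of_nonneg_left hU (mul_nonneg hT hn.le)
  have e : n ^ 2 / 2 * ((c - 2) * f * (1 - 3 / n) + 4 * T * (1 - 1 / n) - 12 / n ^ 2 - P)
      = (c - 2) * f * (n * (n - 3) / 2) + T * n * (2 * n - 2) - 6 - n ^ 2 / 2 * P := by
    field_simp
    ring
  have h2 : 0 < n ^ 2 / 2 * ((c - 2) * f * (1 - 3 / n) + 4 * T * (1 - 1 / n) - 12 / n ^ 2 - P) :=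
    mul_pos (by positivity) hS
  rw [e] at h2
  linarith

/-- **THEOREM J3, the two-endpoint principle.**  A concave quadratic `A + Bξ − Cξ²` (`C ≥ 0`) that is positive at `ξ = 0` and at
`ξ = ξ₀ > 0` is positive on the whole interval `[0, ξ₀]`; `S_σ(ξ)` is such a function minus a supremum of affine functions of `ξ`
(convex), so `S_σ(0) > 0` and `S_σ(1/n₀) > 0` give `S_σ(1/n) > 0` for EVERY `n ≥ n₀` (apply this lemma to `A + Bξ − Cξ² − (α + βξ)` for
each affine piece).
research route conditional on HC_CM; not a corollary; Q11.4-sentence-2 already refuted in dim ≥ 3. [folklore] -/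
theorem concave_quadratic_pos (A B C ξ₀ ξ : ℚ) (hC : 0 ≤ C) (hξ₀ : 0 < ξ₀) (h0 : 0 < A) (h1 : 0 < A + B * ξ₀ - C * ξ₀ ^ 2)
    (hξ : 0 ≤ ξ) (hξ1 : ξ ≤ ξ₀) : 0 < A + B * ξ - C * ξ ^ 2 := by
  have hξ₀' : ξ₀ ≠ 0 := ne_of_gt hξ₀
  set t := ξ / ξ₀ with ht
  have ht0 : 0 ≤ t := div_nonneg hξ hξ₀.le
  have ht1 : t ≤ 1 := (div_le_one hξ₀).2 hξ1
  have hξt : ξ = t * ξ₀ := by rw [ht]; field_simp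
  have key : A + B * ξ - C * ξ ^ 2 = (A + t * ((A + B * ξ₀ - C * ξ₀ ^ 2) - A)) + C * ξ₀ ^ 2 * (t * (1 - t)) := by
    rw [hξt]; ring
  have hconv : 0 < A + t * ((A + B * ξ₀ - C * ξ₀ ^ 2) - A) := by
    rcases le_total A (A + B * ξ₀ - C * ξ₀ ^ 2) with hle | hle
    · nlinarith [mul_nonneg ht0 (sub_nonneg.2 hle)]
    · nlinarith [mul_nonneg (sub_nonneg.2 ht1) (sub_nonneg.2 hle)]
  have hrest : 0 ≤ C * ξ₀ ^ 2 * (t * (1 - t)) :=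
    mul_nonneg (mul_nonneg hC (sq_nonneg _)) (mul_nonneg ht0 (sub_nonneg.2 ht1))
  rw [key]
  linarith

/-- **Pure slots are neutral.**  For the identity label (`s_1 ≡ f`, `c_1(1) = 3f/2`) the kernel at the pair `(1,1)` is
`f − 2ξ·(3f/2) = f(1 − 3ξ)`: exactly the amount `f·n(n−3)/2 = (n²/2)·f(1−3/n)` a pure slot adds to the budget; when the supremum for
`h = 1` is attained at `(1,1)` (all `T ≤ f/2 − 2f/n`), adding pure slots changes neither side of the certificate.
research route conditional on HC_CM; not a corollary; Q11.4-sentence-2 already refuted in dim ≥ 3. [folklore] -/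
theorem pure_slot_kernel_at_one (f T ξ : ℚ) : f / 1 + T * (2 - 1 / 1 - 1 / 1) - ξ * (3 / 2 * f / 1 + 3 / 2 * f / 1) = f * (1 - 3 * ξ) := by
  ring

/-- **The `c ≥ 5` δ-argument.**  With `δ_h := f(1−3ξ) − Ψ_h(T,ξ) ≥ δ_min > 0` for every non-identity label and
`D := 2f(1−3ξ) − 4T(1−ξ) + 12ξ²`, every multiset of `c ≥ 5` carrier labels has `S_σ(ξ) = Σ_{h∈σ} δ_h − D ≥ c·δ_min − D ≥ 5δ_min − D`;
so `5 δ_min > D` at both endpoints excludes ALL `c ≥ 5` multisets at once.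
research route conditional on HC_CM; not a corollary; Q11.4-sentence-2 already refuted in dim ≥ 3. [folklore] -/
theorem five_slots_uniform (c : ℕ) (δmin D sumδ : ℚ) (hc : 5 ≤ c) (hδ : 0 < δmin) (h5 : D < 5 * δmin) (hsum : (c : ℚ) * δmin ≤ sumδ) :
    0 < sumδ - D := by
  have hc' : (5 : ℚ) ≤ c := by exact_mod_cast hc
  nlinarith

/-- The certificate rewritten in `δ`-form: `S_σ = Σ_{h∈σ} (f(1−3ξ) − Ψ_h) − D` with `D = 2f(1−3ξ) − 4T(1−ξ) + 12ξ²`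
(here for `c` summands with `Σ Ψ = P`).
research route conditional on HC_CM; not a corollary; Q11.4-sentence-2 already refuted in dim ≥ 3. [folklore] -/
theorem certificate_delta_form (c f T ξ P : ℚ) :
    (c - 2) * f * (1 - 3 * ξ) + 4 * T * (1 - ξ) - 12 * ξ ^ 2 - P
      = (c * (f * (1 - 3 * ξ)) - P) - (2 * f * (1 - 3 * ξ) - 4 * T * (1 - ξ) + 12 * ξ ^ 2) := by
  ring

/-! ### §5 The endpoint arithmetic of the certificates of record (maximising kernel pairs from `lagr2.py`, exact) -/

/-- **`G₂₄`, signature `(−2, −7a, 3)` (the worst of the 402 signatures; one of THEOREM J2's 21 open multisets), `T = 3/8`, `ξ = 0`:**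
kernel maxima `Ψ_{−2} = K(1,1) = 2`, `Ψ_{−7a} = K(14,14) = 3/14 + (3/8)(2 − 2/14) = 51/56`, `Ψ_{3A} = K(3,3) = 1 + (3/8)(4/3) = 3/2`;
`S(0) = f + 4T − ΣΨ = 5/56 > 0`.
research route conditional on HC_CM; not a corollary; Q11.4-sentence-2 already refuted in dim ≥ 3. [folklore] -/
theorem g24_worst_at_zero :
    (3 : ℚ) / 14 + 3 / 8 * (2 - 1 / 14 - 1 / 14) = 51 / 56 ∧ (1 : ℚ) + 3 / 8 * (2 - 1 / 3 - 1 / 3) = 3 / 2 ∧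
    (3 : ℚ) + 4 * (3 / 8) - (2 + 51 / 56 + 3 / 2) = 5 / 56 ∧ (0 : ℚ) < 5 / 56 := by
  refine ⟨by norm_num, by norm_num, by norm_num, by norm_num⟩

/-- **`G₂₄`, `(−2, −7a, 3)`, `T = 3/8`, `ξ = 1/16` (`n₀ = 16`):** maxima `Ψ_{−2} = K(1,1) = 2 − 6/16 = 13/8`,
`Ψ_{−7a} = K(7,14) = 3/14 + (3/8)(2 − 1/7 − 1/14) − (1/16)(0/7 + 6/14) = 6/7`, `Ψ_{3A} = K(3,3) = 1 + 1/2 − (1/16)·3 = 21/16`;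
`S(1/16) = 3(1 − 3/16) + (3/2)(1 − 1/16) − 12/256 − ΣΨ = 1/448 > 0`.  With §4: no datum for any `n ≥ 16`.
research route conditional on HC_CM; not a corollary; Q11.4-sentence-2 already refuted in dim ≥ 3. [folklore] -/
theorem g24_worst_at_sixteen :
    (2 : ℚ) - (1 / 16) * (3 + 3) = 13 / 8 ∧
    (3 : ℚ) / 14 + 3 / 8 * (2 - 1 / 7 - 1 / 14) - 1 / 16 * (0 / 7 + 6 / 14) = 6 / 7 ∧
    (1 : ℚ) + 3 / 8 * (2 - 1 / 3 - 1 / 3) - 1 / 16 * (9 / 2 / 3 + 9 / 2 / 3) = 21 / 16 ∧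
    (3 : ℚ) * (1 - 3 / 16) + 4 * (3 / 8) * (1 - 1 / 16) - 12 / 16 ^ 2 - (13 / 8 + 6 / 7 + 21 / 16) = 1 / 448 ∧ (0 : ℚ) < 1 / 448 := by
  refine ⟨by norm_num, by norm_num, by norm_num, by norm_num, by norm_num⟩

/-- **`η₅ = PSL₂(11)` on its 5-dimensional `ℚ(√−11)`-representation, signature `(11a, 2A, 3A)` (THEOREM J2's open Hurwitz-type
multiset), `T = 19/48`:** at `ξ = 0`: `Ψ_{11a} = K(11,11) = 5/11 + (19/48)(20/11) = 155/132`, `Ψ_{2A} = K(1,1) = 3`,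
`Ψ_{3A} = K(3,3) = 5/3 + (19/48)(4/3) = 79/36`, `S(0) = 5 + 4T − ΣΨ = 85/396 > 0`; at `ξ = 1/13` (`n₀ = 13`):
`Ψ_{11a} = K(11,11) = 155/132 − (1/13)(15/11)`, `Ψ_{2A} = K(2,2) = 5/2 + 19/48 − (1/13)·7`, `Ψ_{3A} = 79/36 − (1/13)·5`,
`S(1/13) = 37/267696 > 0`.
research route conditional on HC_CM; not a corollary; Q11.4-sentence-2 already refuted in dim ≥ 3. [folklore] -/
theorem eta5_hurwitz_type :
    (5 : ℚ) / 11 + 19 / 48 * (2 - 1 / 11 - 1 / 11) = 155 / 132 ∧ (5 : ℚ) / 3 + 19 / 48 * (2 - 1 / 3 - 1 / 3) = 79 / 36 ∧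
    (5 : ℚ) + 4 * (19 / 48) - (155 / 132 + 3 + 79 / 36) = 85 / 396 ∧
    (155 : ℚ) / 132 - 1 / 13 * (15 / 11) = 1835 / 1716 ∧ (5 : ℚ) / 2 + 19 / 48 - 1 / 13 * 7 = 1471 / 624 ∧
    (79 : ℚ) / 36 - 1 / 13 * 5 = 847 / 468 ∧
    (5 : ℚ) * (1 - 3 / 13) + 4 * (19 / 48) * (1 - 1 / 13) - 12 / 13 ^ 2 - (1835 / 1716 + 1471 / 624 + 847 / 468) = 37 / 267696 ∧
    (0 : ℚ) < 37 / 267696 := by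
  refine ⟨by norm_num, by norm_num, by norm_num, by norm_num, by norm_num, by norm_num, by norm_num, by norm_num⟩

/-- **`G₂₄`, all carrier multisets with `c ≥ 5` at once (`T = 13/48`):** the least slot deficit is `δ_{−2}`:
at `ξ = 0`, `δ_min = 3 − 2 = 1` and `D = 6 − 13/12 = 59/12 < 5`; at `ξ = 1/8` (`n₀ = 8`), `δ_min = 3(1 − 3/8) − Ψ_{−2} = 29/48` with
`Ψ_{−2}(13/48, 1/8) = K(2,2) = 3/2 + 13/48 − (1/8)·4 = 61/48`, and `D = 6(1 − 3/8) − (13/12)(7/8) + 12/64 = 287/96 < 5·29/48`.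
research route conditional on HC_CM; not a corollary; Q11.4-sentence-2 already refuted in dim ≥ 3. [folklore] -/
theorem g24_five_slots :
    (6 : ℚ) - 4 * (13 / 48) = 59 / 12 ∧ (59 : ℚ) / 12 < 5 * 1 ∧
    (3 : ℚ) / 2 + 13 / 48 - 1 / 8 * (4 / 2 + 4 / 2) = 61 / 48 ∧ (3 : ℚ) * (1 - 3 / 8) - 61 / 48 = 29 / 48 ∧
    (2 : ℚ) * 3 * (1 - 3 / 8) - 4 * (13 / 48) * (1 - 1 / 8) + 12 / 8 ^ 2 = 287 / 96 ∧ (287 : ℚ) / 96 < 5 * (29 / 48) := by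
  refine ⟨by norm_num, by norm_num, by norm_num, by norm_num, by norm_num, by norm_num⟩

/-- **The Euclidean obstruction (LEMMA E), arithmetic part:** the two label multisets on which the Lagrangian bound is identically
tight — `F₂₁`'s `(3a, 3a, 3a)` and `η₅`'s `(2A, 2A, 2A, 2A)` — are the Euclidean signatures `1/3 + 1/3 + 1/3 = 1` and
`1/2 + 1/2 + 1/2 + 1/2 = 2`: their orbifold groups are virtually abelian, so the non-solvable `PSL₂(11)` admits no generating
`(2,2,2,2)`-system (the multiset is not a signature), while the solvable `F₂₁` does admit `(3,3,3)` (closed by THEOREM J2 (iii) for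
`n ≥ 10`).  Here: the two Euclidean identities and, for contrast, the hyperbolic `(2,5,5)` of `η₅`: `1/2 + 1/5 + 1/5 < 1`.
research route conditional on HC_CM; not a corollary; Q11.4-sentence-2 already refuted in dim ≥ 3. [folklore] -/
theorem euclidean_signatures :
    (1 : ℚ) / 3 + 1 / 3 + 1 / 3 = 1 ∧ (1 : ℚ) / 2 + 1 / 2 + 1 / 2 + 1 / 2 = 2 ∧ (1 : ℚ) / 2 + 1 / 5 + 1 / 5 < 1 := by
  refine ⟨by norm_num, by norm_num, by norm_num⟩

/-! ### §6 THEOREM J3 at `k = 3` — the windows `S^{(n−3,3)}` (block b02.32 P.S.; cubic kernel) -/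

/-- `d₃ = dim S^{(n−3,3)} = C(n,3) − C(n,2) = n(n−1)(n−5)/6` (Young's rule `M³ = S^{(n−3,3)} ⊕ M²`, `n ≥ 6`).
research route conditional on HC_CM; not a corollary; Q11.4-sentence-2 already refuted in dim ≥ 3. [folklore] -/
theorem d3_formula (n : ℚ) : n * (n - 1) * (n - 2) / 6 - n * (n - 1) / 2 = n * (n - 1) * (n - 5) / 6 := by ring

/-- **LEMMA Q3, the multiplier at `k = 3`:** one term of `T·n²·u = (T/3)·Σ_{i,j,l} ℓ_iℓ_jℓ_l(3 − 1/ℓ_i − 1/ℓ_j − 1/ℓ_l)`: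
`abc(3 − 1/a − 1/b − 1/c) = 3abc − bc − ac − ab`.
research route conditional on HC_CM; not a corollary; Q11.4-sentence-2 already refuted in dim ≥ 3. [folklore] -/
theorem multiplier3_term (a b c : ℚ) (ha : a ≠ 0) (hb : b ≠ 0) (hc : c ≠ 0) :
    a * b * c * (3 - 1 / a - 1 / b - 1 / c) = 3 * a * b * c - b * c - a * c - a * b := by
  field_simp

/-- **LEMMA Q3, the single-cycle coefficient `r_h` for an ODD cycle length `a`:** collecting the transversal correction `a²s/3`, the removed
diagonal of the `(2,1)`-type count `−a·s·(a−1)/2`, the pair correction `+a s/2`, the type-`(3)` regular orbits `s·(a−1)(a−2)/6` and the `M²`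
within-cycle orbits `−s(a−1)/2` leaves the constant `5s/6` (the `[3 ∣ a]` terms `−s/3 + s_h(a/3)` are added separately).
research route conditional on HC_CM; not a corollary; Q11.4-sentence-2 already refuted in dim ≥ 3. [folklore] -/
theorem r_odd_coefficient (a s : ℚ) :
    a ^ 2 * s / 3 - a * s * ((a - 1) / 2) + a * s / 2 + s * ((a - 1) * (a - 2) / 6) - s * ((a - 1) / 2) = 5 / 6 * s := by ring

/-- **LEMMA Q3, `r_h` for an EVEN cycle length `a`** (antipodal pair orbit: `(2,1)`-diagonal `−s·a/2` extra, `M²` within-cycle `⌊(a−1)/2⌋ = a/2 − 1`):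
the constant is `4s/3` (then `− s_h(a/2)` and the `[3 ∣ a]` terms are added separately).
research route conditional on HC_CM; not a corollary; Q11.4-sentence-2 already refuted in dim ≥ 3. [folklore] -/
theorem r_even_coefficient (a s : ℚ) :
    a ^ 2 * s / 3 - a * s * (a / 2 - 1) + a * s / 2 + s * ((a - 1) * (a - 2) / 6) - s * (a / 2 - 1) - s * a / 2 = 4 / 3 * s := by ring

/-- **LEMMA Q3, the pair coefficient `q_h(a,b)`:** `(2,1)`-type regular orbits `s·g·⌊(a−1)/2⌋` minus the pair and transversal corrections
`(1+a)·s·g/2`: coefficient `−1` of `s·g` for odd `a`, `−3/2` for even `a`.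
research route conditional on HC_CM; not a corollary; Q11.4-sentence-2 already refuted in dim ≥ 3. [folklore] -/
theorem q_coefficients (a : ℚ) : (a - 1) / 2 - (1 + a) / 2 = -1 ∧ (a - 2) / 2 - (1 + a) / 2 = -3 / 2 := by
  constructor <;> ring

/-- **The cubic kernel at the identity triple:** `K³_h(1,1,1; T, ξ) = e − 6eξ + 5eξ²` (`Q_h(1,1) = −2e` on three pairs, `r_h(1) = 5e/6` on
three singles), and `(n³/6)·e(1 − 6/n + 5/n²) = e·d₃` — LEMMA K3 is exact at `y = 1`, and a pure slot (`e = f`) adds to the bound exactly the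
`f·d₃` it adds to the budget.
research route conditional on HC_CM; not a corollary; Q11.4-sentence-2 already refuted in dim ≥ 3. [folklore] -/
theorem kernel3_at_identity (e n : ℚ) (hn : n ≠ 0) :
    e + (1 / n) * (3 * (-2 * e)) + 2 * (1 / n) ^ 2 * (3 * (5 / 6 * e)) = e * (1 - 6 / n + 5 / n ^ 2) ∧
    n ^ 3 / 6 * (e * (1 - 6 / n + 5 / n ^ 2)) = e * (n * (n - 1) * (n - 5) / 6) := by
  constructor
  · field_simp
    ring
  · field_simp
    ring

/-- **THEOREM J3 (k = 3), the budget algebra** on the concave minorant: from `F + T n² U ≤ (n³/6)·P` (LEMMA K3 summed over the slots),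
`U ≥ 2n − 2`, `T ≥ 0`, `c ≥ 2`, `f ≥ 0` and `S̃(1/n) = (c−2)f(1 − 6/n) + 12T(1 − 1/n) − 36/n³ − P > 0`:
`F < (c−2)·f·n(n−1)(n−5)/6 − 6` — the budget of a Weil-type sixfold fails (the dropped `+5(c−2)f/n²` only helps).
research route conditional on HC_CM; not a corollary; Q11.4-sentence-2 already refuted in dim ≥ 3. [cite: vanGeemen1994HodgeAV, (5.4.1)] -/
theorem budget_exclusion3 (n f T c P F U : ℚ) (hn : 0 < n) (hT : 0 ≤ T) (hc : 2 ≤ c) (hf : 0 ≤ f)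
    (hK : F + T * n ^ 2 * U ≤ n ^ 3 / 6 * P) (hU : 2 * n - 2 ≤ U)
    (hS : 0 < (c - 2) * f * (1 - 6 / n) + 12 * T * (1 - 1 / n) - 36 / n ^ 3 - P) :
    F < (c - 2) * f * (n * (n - 1) * (n - 5) / 6) - 6 := by
  have hn' : n ≠ 0 := ne_of_gt hn
  have h1 : T * n ^ 2 * (2 * n - 2) ≤ T * n ^ 2 * U := mul_le_mul_of_nonneg_left hU (mul_nonneg hT (sq_nonneg n))
  have e : n ^ 3 / 6 * ((c - 2) * f * (1 - 6 / n) + 12 * T * (1 - 1 / n) - 36 / n ^ 3 - P)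
      = (c - 2) * f * (n * (n - 1) * (n - 5) / 6) - (c - 2) * f * (5 * n / 6) + T * n ^ 2 * (2 * n - 2) - 6 - n ^ 3 / 6 * P := by
    field_simp
    ring
  have h2 : 0 < n ^ 3 / 6 * ((c - 2) * f * (1 - 6 / n) + 12 * T * (1 - 1 / n) - 36 / n ^ 3 - P) := mul_pos (by positivity) hS
  rw [e] at h2
  have h3 : 0 ≤ (c - 2) * f * (5 * n / 6) := mul_nonneg (mul_nonneg (by linarith) hf) (by positivity)
  linarith

/-- **The two-endpoint principle with a cubic term:** `A + Bξ − Cξ² − Dξ³` (`C, D ≥ 0`) positive at `0` and at `ξ₀ > 0` is positive on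
`[0, ξ₀]` — used for `S̃_σ(ξ) = (c−2)f(1−6ξ) + 12T(1−ξ) − 36ξ³ − ΣΨ³⁺` piece by convex piece.
research route conditional on HC_CM; not a corollary; Q11.4-sentence-2 already refuted in dim ≥ 3. [folklore] -/
theorem concave_cubic_pos (A B C D ξ₀ ξ : ℚ) (hC : 0 ≤ C) (hD : 0 ≤ D) (hξ₀ : 0 < ξ₀) (h0 : 0 < A)
    (h1 : 0 < A + B * ξ₀ - C * ξ₀ ^ 2 - D * ξ₀ ^ 3) (hξ : 0 ≤ ξ) (hξ1 : ξ ≤ ξ₀) :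
    0 < A + B * ξ - C * ξ ^ 2 - D * ξ ^ 3 := by
  have hξ₀' : ξ₀ ≠ 0 := ne_of_gt hξ₀
  set t := ξ / ξ₀ with ht
  have ht0 : 0 ≤ t := div_nonneg hξ hξ₀.le
  have ht1 : t ≤ 1 := (div_le_one hξ₀).2 hξ1
  have hξt : ξ = t * ξ₀ := by rw [ht]; field_simp
  have key : A + B * ξ - C * ξ ^ 2 - D * ξ ^ 3
      = (A + t * ((A + B * ξ₀ - C * ξ₀ ^ 2 - D * ξ₀ ^ 3) - A)) + C * ξ₀ ^ 2 * (t * (1 - t)) + D * ξ₀ ^ 3 * (t * (1 - t) * (1 + t)) := by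
    rw [hξt]; ring
  have hconv : 0 < A + t * ((A + B * ξ₀ - C * ξ₀ ^ 2 - D * ξ₀ ^ 3) - A) := by
    rcases le_total A (A + B * ξ₀ - C * ξ₀ ^ 2 - D * ξ₀ ^ 3) with hle | hle
    · nlinarith [mul_nonneg ht0 (sub_nonneg.2 hle)]
    · nlinarith [mul_nonneg (sub_nonneg.2 ht1) (sub_nonneg.2 hle)]
  have h2 : 0 ≤ C * ξ₀ ^ 2 * (t * (1 - t)) := mul_nonneg (mul_nonneg hC (sq_nonneg _)) (mul_nonneg ht0 (sub_nonneg.2 ht1))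
  have h3 : 0 ≤ D * ξ₀ ^ 3 * (t * (1 - t) * (1 + t)) :=
    mul_nonneg (mul_nonneg hD (pow_nonneg hξ₀.le 3)) (mul_nonneg (mul_nonneg ht0 (sub_nonneg.2 ht1)) (by linarith))
  rw [key]
  linarith

/-- **LEMMA μ₃ (minimal codimension on `S^{(n−3,3)}`), the branching step:** for `y ≠ 1` WITH a fixed point, restriction to `S_{n−1}`
(`S^{(n−3,3)}↓ = S^{(n−4,3)} ⊕ S^{(n−3,2)}`) and induction + LEMMA μ give `codim ≥ (n−3)(n−6)/2 + (n−4) = (n−2)(n−5)/2` — the value at a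
transposition (`C(n−2,2) − (n−2)`).
research route conditional on HC_CM; not a corollary; Q11.4-sentence-2 already refuted in dim ≥ 3. [folklore] -/
theorem mu3_branching (n : ℚ) :
    (n - 3) * (n - 6) / 2 + (n - 4) = (n - 2) * (n - 5) / 2 ∧ (n - 2) * (n - 3) / 2 - (n - 2) = (n - 2) * (n - 5) / 2 := by
  constructor <;> ring

/-- **LEMMA μ₃, fixed-point-free elements:** a `3`-subset fixed by a fixed-point-free `y` is one of its `3`-cycles (`≤ n/3` of them), every
other orbit on `3`-subsets has length `≥ 2`, so `E_1(S^{(n−3,3)}; y) ≤ (C(n,3) + n/3)/2` and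
`codim ≥ C(n,3)/2 − C(n,2) − n/6 ≥ (n−2)(n−5)/2` for `n ≥ 12` (the cases `7 ≤ n ≤ 26` are checked on every cycle type by machine,
`weilcov/g72/john/mu3_check.py`).  With the branching step: `min_{y ≠ 1} codim = (n−2)(n−5)/2` for all `n ≥ 7`.
research route conditional on HC_CM; not a corollary; Q11.4-sentence-2 already refuted in dim ≥ 3. [folklore] -/
theorem mu3_fixed_point_free (n : ℚ) (hn : 12 ≤ n) :
    (n - 2) * (n - 5) / 2 ≤ n * (n - 1) * (n - 2) / 6 / 2 - n * (n - 1) / 2 - n / 6 := by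
  nlinarith [mul_nonneg (by linarith : (0:ℚ) ≤ n - 12) (mul_nonneg (by linarith : (0:ℚ) ≤ n - 12) (by linarith : (0:ℚ) ≤ n))]

/-- **The Euclidean signature `(3a)³` of `F₂₁` at `k = 3` (tight-signature lemma):** the three slot deficits are codimensions of fixed
spaces of `y_j³` on `S^{(n−3,3)}`, each `0` or `≥ (n−2)(n−5)/2` (LEMMA μ₃), and must sum to `6`: impossible for `n ≥ 8` since
`(n−2)(n−5)/2 > 6` there (then all `y_j³ = 1` and the sum is `0`).
research route conditional on HC_CM; not a corollary; Q11.4-sentence-2 already refuted in dim ≥ 3. [folklore] -/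
theorem tight3_signature (n : ℚ) (hn : 8 ≤ n) : 6 < (n - 2) * (n - 5) / 2 := by
  nlinarith [mul_nonneg (by linarith : (0:ℚ) ≤ n - 8) (by linarith : (0:ℚ) ≤ n - 8)]

/-- **`G₂₄`, `(−2, −7a, 3A)` at `k = 3` (`T = 17/144`), `ξ = 0`:** `Ψ³_{−2} = K³(1,1,1) = 2`, `Ψ³_{−7a} = K³(14,14,14) = 3/14 + (17/144)(39/7) = 293/336`,
`Ψ³_{3A} = K³(3,3,3) = 1 + (17/144)·4 = 53/36`; `S̃(0) = f + 12T − ΣΨ³ = 73/1008 > 0`.  (At `ξ = 1/19`: `S̃ = 15031/6913872 > 0`, `lagr3.py`,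
maximisers `(2,2,2)`, tail, `(3,3,3)`.)  Hence no datum in `S^{(n−3,3)}` with this signature for any `n ≥ 19`.
research route conditional on HC_CM; not a corollary; Q11.4-sentence-2 already refuted in dim ≥ 3. [folklore] -/
theorem g24_worst_k3_at_zero :
    (3 : ℚ) / 14 + 17 / 144 * (39 / 7) = 293 / 336 ∧ (1 : ℚ) + 17 / 144 * 4 = 53 / 36 ∧
    (3 : ℚ) + 12 * (17 / 144) - (2 + 293 / 336 + 53 / 36) = 73 / 1008 ∧ (0 : ℚ) < 73 / 1008 := by
  refine ⟨by norm_num, by norm_num, by norm_num, by norm_num⟩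

/-- **`η₅`, `(11a, 2A, 3A)` at `k = 3` (`T = 17/144`), `ξ = 0`:** `Ψ³_{11a} = K³(11,11,11) = 5/11 + (17/144)(60/11) = 145/132`, `Ψ³_{2A} = 3`,
`Ψ³_{3A} = K³(3,3,3) = 5/3 + (17/144)·4 = 77/36`; `S̃(0) = 5 + 12T − ΣΨ³ = 71/396 > 0` (and `S̃(1/16) = 665/101376 > 0`: no datum for `n ≥ 16`).
research route conditional on HC_CM; not a corollary; Q11.4-sentence-2 already refuted in dim ≥ 3. [folklore] -/
theorem eta5_hurwitz_type_k3_at_zero :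
    (5 : ℚ) / 11 + 17 / 144 * (60 / 11) = 145 / 132 ∧ (5 : ℚ) / 3 + 17 / 144 * 4 = 77 / 36 ∧
    (5 : ℚ) + 12 * (17 / 144) - (145 / 132 + 3 + 77 / 36) = 71 / 396 ∧ (0 : ℚ) < 71 / 396 := by
  refine ⟨by norm_num, by norm_num, by norm_num, by norm_num⟩

end LagrangianPairWindows

end Summit.HodgeConjecture.HodgeConjecture.Ring2.WeilCoverage

end
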